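import Summits.ValiantsHypothesis.ValiantsHypothesis.Theorems.GrenetZeonDualUnipotentThreeHalvesHeavyTopPatternSlow
import Summits.ValiantsHypothesis.ValiantsHypothesis.Theorems.GrenetZeonDualUnipotentThreeHalvesHeavyTopThreeFour
import Summits.ValiantsHypothesis.ValiantsHypothesis.Theorems.GrenetZeonDualUnipotentThreeHalvesHeavyTopXElevenFramePowers

/-!
# `GrenetZeon.DualUnipotentThreeHalves` (stmt-ValiantsHypothesis-24318), R2 heavy-top instrument — the `(5,9)` ✗-candidate X11, KERNEL ROUTE part 2:
# the POWER-CURRENCY OBSTRUCTION INTERFACE for linear pencils, and the reduction «`HeavyTopInst 5 9` ⇒ every frame pencil is `Slow`» to word sums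

Experiment cell «val-heavytop-census» (D-0160), engine seat val-htc-eng-2 g4.  This seat's machine result (crux workfile `CENSUS-X11-NOT-SLOW.md`, exact over ℚ,
two legs): a 25-dimensional section `W` of lead-g3's sandwich frame `B = (1 | S₃(7) | 1) ⊂ M₉` (EXTREMISER X11, PREREG Q14) carries a linear pencil that is NOT
`Slow 5 9` — so `HeavyTopInst 5 9` is FALSE at machine level.  The kernel route is: (part 1, ✓ `…HeavyTopXElevenFramePowers`) `X⁹ = 0` on the frame;
(THIS FILE) for EVERY linear pencil `N = linPencil B` whose letters `B c` lie in the frame, `HeavyTopInst 5 9 → Slow 5 9 N` (✓ `slow_of_flagCheap`; `N` is affine,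
`N⁹ = 0` by part 1 via ✓ `linPencil_pow_eq_zero`, and the heavy-top hypothesis is vacuous at `n = 5`: `dim K ≤ 25 ≤ 16·9·⌊√5⌋ + 80`), and `Slow` for a LINEAR pencil
is a statement about WORD SUMS (coefficient extraction ✓ `coeff_pow_line_eq_sum_gword`): some `K` with `(k+1)·n < dim K` on whose lines every sum of the words of
length `n − 1` in `(N(x), N_lin(v))` with more than `k` letters `N_lin(v)` vanishes; (parts 3–6, successor work) the four dimension bounds `D₀ ≤ 5, D₁ ≤ 10, D₂ ≤ 15,
D₃ ≤ 20` for the specific section `W` of the memo, which contradict `(k+1)·5 < dim K`.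

* `linPencil_map_lineSubst` — `N(x + s·v) = (Σ x_c B_c) + s·(Σ v_c B_c)` for a linear pencil (the analogue of ✓ `patPencil_map_lineSubst`);
* ★ `wordsums_of_slow_linPencil` — the power-currency obstruction interface: `Slow n m (linPencil B)` ⇒ `∃ K k, (k+1)·n < dim K ∧` every word sum of length `n−1`
  with `j > k` letters `Σ v_c B_c` vanishes along `K` (any `n, m, B`);
* `frame_sum_smul` — linearity of the frame in its 27 coordinates; `frame_linPencil_pow_nine` — `N⁹ = 0` for every frame-valued linear pencil on `ℂ^{5×5}`;
* ★ `slow_of_heavyTopInst_five_nine` — `HeavyTopInst 5 9 → Slow 5 9 (linPencil B)` for every frame-valued `B : Fin 5 × Fin 5 → B`;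
* ★ `wordsums_of_heavyTopInst_five_nine` — the composite: `HeavyTopInst 5 9` ⇒ for every frame-valued `B`, some `K ≤ ℂ^{25}`, `k ≤ 3`, `5k + 6 ≤ dim K`, with all word sums
  of length `4` with `> k` letters from `K` vanishing.  The X11 kernel target is therefore: for the memo's `B` (basis of `W`), such `(K, k)` cannot exist.

Frame coordinates `p : Fin 27 → ℂ` in the order `x₀…x₄, x_T, x_B` (`p 0…p 6`, row `f`), `y = p 7`, `n01 n02 n03 n04 n12 n13 n14 n23 n24 n34` (`p 8…p 17`), `a = p 18`
(on `c = E_{T,0} − E_{4,B}`), `b = p 19` (on `v = E_{4,T} + E_{B,0}`), `z₀…z₄, z_T, z_B` (`p 20…p 26`, column `ℓ`); basis order `e_f, e_0..e_4, e_T, e_B, e_ℓ` — as in part 1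
and the memo.  Honest framing: infrastructure for a census ✗-cell (`C₀ = 1` sliver); nothing here proves or refutes `HeavyTopLaw`/`HeavyTopSlowLaw`, 24318, S3 or 8062;
`HeavyTopInst 5 9` is NOT decided in the kernel by this file; `VP ≠ VNP` is NOT proved.  No definitions (the frame is an inline literal).  [this seat]
-/

-- single-conjunct layout: Sub = Summit, duplicated namespace component intended
set_option linter.dupNamespace false
set_option autoImplicit false

noncomputable section

namespace Summit.ValiantsHypothesis.ValiantsHypothesis.Theorems.GrenetZeon.RadicalSplit

open MvPolynomial Matrix
open scoped BigOperators
open Summit.ValiantsHypothesis.ValiantsHypothesis.Cruxes.TwoDimCoefficients.DimTwoCases (AffMat IsAffine)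
open Summit.ValiantsHypothesis.ValiantsHypothesis.Theorems.GrenetZeon.SlowCore (Slow slow_of_flagCheap)
open Summit.ValiantsHypothesis.ValiantsHypothesis.Theorems.GrenetZeon.HeavyTopXElevenFramePowers (xFrame_pow_nine)

section LinearPencils

variable {n m : ℕ}

/-- **Line substitution of a linear pencil**: `N(x + s·v) = (Σ_c x_c B_c) + s·(Σ_c v_c B_c)` (entries in `ℂ[s] = MvPolynomial (Fin 1) ℂ`). -/
theorem linPencil_map_lineSubst (B : Fin n × Fin n → Matrix (Fin m) (Fin m) ℂ) (x v : Fin n × Fin n → ℂ) :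
    (linPencil B).map (lineSubst x v) =
      (∑ c, x c • B c).map MvPolynomial.C + (MvPolynomial.X 0 : MvPolynomial (Fin 1) ℂ) • (∑ c, v c • B c).map MvPolynomial.C := by
  refine Matrix.ext fun i j => ?_
  simp only [Matrix.map_apply, linPencil_apply, map_sum, map_mul, Matrix.add_apply, Matrix.smul_apply, Matrix.sum_apply,
    smul_eq_mul, lineSubst, MvPolynomial.aeval_X, MvPolynomial.aeval_C, Fin.sum_univ_one, MvPolynomial.algebraMap_eq]
  rw [Finset.mul_sum, ← Finset.sum_add_distrib]
  exact Finset.sum_congr rfl fun c _ => by ring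

/-- ★ **Power-currency obstruction interface for LINEAR pencils.**  If `linPencil B` is `Slow n m`, then there are `K ≤ ℂ^{n×n}` and `k` with
`(k+1)·n < dim K` such that along every line `x + s·v`, `v ∈ K`, every SUM of the words of length `n − 1` in `(Σ x_c B_c, Σ v_c B_c)` with `j > k` letters
`Σ v_c B_c` vanishes (the `s^j`-coefficient of `N(x+sv)^{n−1}`, ✓ `coeff_pow_line_eq_sum_gword`). -/
theorem wordsums_of_slow_linPencil (B : Fin n × Fin n → Matrix (Fin m) (Fin m) ℂ) (h : Slow n m (linPencil B)) :
    ∃ (K : Submodule ℂ (Fin n × Fin n → ℂ)) (k : ℕ), (k + 1) * n < Module.finrank ℂ K ∧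
      ∀ x v : Fin n × Fin n → ℂ, v ∈ K → ∀ j : ℕ, k < j → ∀ i i' : Fin m,
        (∑ f ∈ Finset.univ.filter (fun f : Fin (n - 1) → Bool => (List.ofFn f).count true = j),
            gword (∑ c, x c • B c) (∑ c, v c • B c) (List.ofFn f)) i i' = 0 := by
  classical
  obtain ⟨K, k, hK, hdim⟩ := h
  refine ⟨K, k, hdim, fun x v hv j hj i i' => ?_⟩
  have hdeg := hK x v hv i i'
  rw [linPencil_map_lineSubst] at hdeg
  have hsum : ∑ t ∈ (Finsupp.single (0 : Fin 1) j).support, (Finsupp.single (0 : Fin 1) j) t = j := by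
    rw [Finsupp.support_single _ (by omega : j ≠ 0), Finset.sum_singleton, Finsupp.single_eq_same]
  have hcoeff := MvPolynomial.coeff_eq_zero_of_totalDegree_lt (d := Finsupp.single (0 : Fin 1) j)
    (lt_of_le_of_lt hdeg (by rw [hsum]; exact hj))
  rwa [coeff_pow_line_eq_sum_gword] at hcoeff

end LinearPencils

section Frame

set_option maxHeartbeats 2000000 in
/-- **Linearity of the frame `B = (1 | S₃(7) | 1)` in its 27 coordinates**: `Σ_c x_c • F(coef_c) = F(Σ_c x_c coef_c)`. -/
theorem frame_sum_smul (coef : Fin 5 × Fin 5 → Fin 27 → ℂ) (x : Fin 5 × Fin 5 → ℂ) :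
    (∑ c : Fin 5 × Fin 5, x c • (!![0, coef c 0, coef c 1, coef c 2, coef c 3, coef c 4, coef c 5, coef c 6, coef c 7; 0, 0, coef c 8, coef c 9, coef c 10, coef c 11, 0, 0, coef c 20; 0, 0, 0, coef c 12, coef c 13, coef c 14, 0, 0, coef c 21; 0, 0, 0, 0, coef c 15, coef c 16, 0, 0, coef c 22; 0, 0, 0, 0, 0, coef c 17, 0, 0, coef c 23; 0, 0, 0, 0, 0, 0, coef c 19, -coef c 18, coef c 24; 0, coef c 18, 0, 0, 0, 0, 0, 0, coef c 25; 0, coef c 19, 0, 0, 0, 0, 0, 0, coef c 26; 0, 0, 0, 0, 0, 0, 0, 0, 0] : Matrix (Fin 9) (Fin 9) ℂ)) =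
      (!![0, ∑ c, x c * coef c 0, ∑ c, x c * coef c 1, ∑ c, x c * coef c 2, ∑ c, x c * coef c 3, ∑ c, x c * coef c 4, ∑ c, x c * coef c 5, ∑ c, x c * coef c 6, ∑ c, x c * coef c 7; 0, 0, ∑ c, x c * coef c 8, ∑ c, x c * coef c 9, ∑ c, x c * coef c 10, ∑ c, x c * coef c 11, 0, 0, ∑ c, x c * coef c 20; 0, 0, 0, ∑ c, x c * coef c 12, ∑ c, x c * coef c 13, ∑ c, x c * coef c 14, 0, 0, ∑ c, x c * coef c 21; 0, 0, 0, 0, ∑ c, x c * coef c 15, ∑ c, x c * coef c 16, 0, 0, ∑ c, x c * coef c 22; 0, 0, 0, 0, 0, ∑ c, x c * coef c 17, 0, 0, ∑ c, x c * coef c 23; 0, 0, 0, 0, 0, 0, ∑ c, x c * coef c 19, -∑ c, x c * coef c 18, ∑ c, x c * coef c 24; 0, ∑ c, x c * coef c 18, 0, 0, 0, 0, 0, 0, ∑ c, x c * coef c 25; 0, ∑ c, x c * coef c 19, 0, 0, 0, 0, 0, 0, ∑ c, x c * coef c 26; 0, 0, 0, 0, 0, 0, 0, 0, 0] : Matrix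 (Fin 9) (Fin 9) ℂ) := by
  ext i j
  fin_cases i <;> fin_cases j <;> simp [Matrix.sum_apply, Finset.sum_neg_distrib, mul_neg]

set_option maxHeartbeats 2000000 in
/-- **`N⁹ = 0` for every frame-valued linear pencil on `ℂ^{5×5}`** (part 1 `xFrame_pow_nine` at every point, then the polynomial identity by
✓ `linPencil_pow_eq_zero`). -/
theorem frame_linPencil_pow_nine (coef : Fin 5 × Fin 5 → Fin 27 → ℂ) :
    linPencil (fun c : Fin 5 × Fin 5 => (!![0, coef c 0, coef c 1, coef c 2, coef c 3, coef c 4, coef c 5, coef c 6, coef c 7; 0, 0, coef c 8, coef c 9, coef c 10, coef c 11, 0, 0, coef c 20; 0, 0, 0, coef c 12, coef c 13, coef c 14, 0, 0, coef c 21; 0, 0, 0, 0, coef c 15, coef c 16, 0, 0, coef c 22; 0, 0, 0, 0, 0, coef c 17, 0, 0, coef c 23; 0, 0, 0, 0, 0, 0, coef c 19, -coef c 18, coef c 24; 0, coef c 18, 0, 0, 0, 0, 0, 0, coef c 25; 0, coef c 19, 0, 0, 0, 0, 0, 0, coef c 26; 0, 0, 0, 0, 0, 0, 0, 0, 0] :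 Matrix (Fin 9) (Fin 9) ℂ)) ^ 9 = 0 := by
  refine linPencil_pow_eq_zero _ fun x => ?_
  rw [frame_sum_smul]
  exact xFrame_pow_nine (∑ c, x c * coef c 0) (∑ c, x c * coef c 1) (∑ c, x c * coef c 2) (∑ c, x c * coef c 3) (∑ c, x c * coef c 4) (∑ c, x c * coef c 5) (∑ c, x c * coef c 6) (∑ c, x c * coef c 7) (∑ c, x c * coef c 8) (∑ c, x c * coef c 9) (∑ c, x c * coef c 10) (∑ c, x c * coef c 11) (∑ c, x c * coef c 12) (∑ c, x c * coef c 13) (∑ c, x c * coef c 14) (∑ c, x c * coef c 15) (∑ c, x c * coef c 16) (∑ c, x c * coef c 17) (∑ c, x c * coef c 18) (∑ c, x c * coef c 19) (∑ c, x c * coef c 20) (∑ c, x c * coef c 21) (∑ c, x c * coef c 22) (∑ c, x c * coef c 23) (∑ c, x c * coef c 24) (∑ c, x c * coef c 25) (∑ c, x c * coef c 26)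

set_option maxHeartbeats 2000000 in
/-- ★ **`HeavyTopInst 5 9` would make every frame-valued linear pencil `Slow 5 9`**: the pencil is affine (✓ `isAffine_linPencil`), `N⁹ = 0`
(`frame_linPencil_pow_nine`), and the heavy-top hypothesis is vacuous at `n = 5` (`dim K ≤ 25 ≤ 16·9·⌊√5⌋ + 16·5`); so `HeavyTopInst 5 9` gives `FlagCheap`,
hence `Slow` (✓ `slow_of_flagCheap`). -/
theorem slow_of_heavyTopInst_five_nine (coef : Fin 5 × Fin 5 → Fin 27 → ℂ) (h : HeavyTopInst 5 9) :
    Slow 5 9 (linPencil (fun c : Fin 5 × Fin 5 => (!![0, coef c 0, coef c 1, coef c 2, coef c 3, coef c 4, coef c 5, coef c 6, coef c 7; 0, 0, coef c 8, coef c 9, coef c 10, coef c 11, 0, 0, coef c 20; 0, 0, 0, coef c 12, coef c 13, coef c 14, 0, 0, coef c 21; 0, 0, 0, 0, coef c 15, coef c 16, 0, 0, coef c 22; 0, 0, 0, 0, 0, coef c 17, 0, 0, coef c 23; 0, 0, 0, 0, 0, 0, coef c 19, -coef c 18, coef c 24; 0, coef c 18, 0, 0, 0, 0, 0, 0, coef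 c 25; 0, coef c 19, 0, 0, 0, 0, 0, 0, coef c 26; 0, 0, 0, 0, 0, 0, 0, 0, 0] : Matrix (Fin 9) (Fin 9) ℂ))) := by
  refine slow_of_flagCheap _ (h _ (isAffine_linPencil _) (frame_linPencil_pow_nine coef) fun K _ => ?_)
  have h1 := Submodule.finrank_le K
  rw [Module.finrank_fintype_fun_eq_card, Fintype.card_prod, Fintype.card_fin] at h1
  have h2 : (25 : ℕ) ≤ 16 * 9 * Nat.sqrt 5 + 16 * 5 := by norm_num
  omega

set_option maxHeartbeats 2000000 in
/-- ★ **The X11 kernel target, isolated.**  `HeavyTopInst 5 9` ⇒ for every frame-valued `B : Fin 5 × Fin 5 → B`, there are `K ≤ ℂ^{25}` and `k ≤ 3` with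
`5k + 6 ≤ dim K` such that along every line of `K` all sums of the length-`4` words in `(Σ x_c B_c, Σ v_c B_c)` with `> k` letters `Σ v_c B_c` vanish.  For the
memo's basis of `W` the four bounds `D_k ≤ 5k + 5` (CENSUS-X11-NOT-SLOW §2) say no such `(K, k)` exists — typing them closes `¬ HeavyTopInst 5 9`. -/
theorem wordsums_of_heavyTopInst_five_nine (coef : Fin 5 × Fin 5 → Fin 27 → ℂ) (h : HeavyTopInst 5 9) :
    ∃ (K : Submodule ℂ (Fin 5 × Fin 5 → ℂ)) (k : ℕ), k ≤ 3 ∧ 5 * k + 6 ≤ Module.finrank ℂ K ∧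
      ∀ x v : Fin 5 × Fin 5 → ℂ, v ∈ K → ∀ j : ℕ, k < j → ∀ i i' : Fin 9,
        (∑ f ∈ Finset.univ.filter (fun f : Fin 4 → Bool => (List.ofFn f).count true = j),
            gword (∑ c, x c • (!![0, coef c 0, coef c 1, coef c 2, coef c 3, coef c 4, coef c 5, coef c 6, coef c 7; 0, 0, coef c 8, coef c 9, coef c 10, coef c 11, 0, 0, coef c 20; 0, 0, 0, coef c 12, coef c 13, coef c 14, 0, 0, coef c 21; 0, 0, 0, 0, coef c 15, coef c 16, 0, 0, coef c 22; 0, 0, 0, 0, 0, coef c 17, 0, 0, coef c 23; 0, 0, 0, 0, 0, 0, coef c 19, -coef c 18, coef c 24; 0, coef c 18, 0, 0, 0, 0, 0, 0, coef c 25; 0, coef c 19, 0, 0, 0, 0, 0, 0, coef c 26; 0, 0, 0, 0, 0, 0, 0, 0, 0] : Matrix (Fin 9) (Fin 9) ℂ)) (∑ c, v c • (!![0, coef c 0, coef c 1, coef c 2, coef c 3, coef c 4, coef c 5, coef c 6, coef c 7; 0, 0, coef c 8, coef c 9, coef c 10, coef c 11, 0, 0, coef c 20; 0, 0, 0, coef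 c 12, coef c 13, coef c 14, 0, 0, coef c 21; 0, 0, 0, 0, coef c 15, coef c 16, 0, 0, coef c 22; 0, 0, 0, 0, 0, coef c 17, 0, 0, coef c 23; 0, 0, 0, 0, 0, 0, coef c 19, -coef c 18, coef c 24; 0, coef c 18, 0, 0, 0, 0, 0, 0, coef c 25; 0, coef c 19, 0, 0, 0, 0, 0, 0, coef c 26; 0, 0, 0, 0, 0, 0, 0, 0, 0] : Matrix (Fin 9) (Fin 9) ℂ)) (List.ofFn f)) i i' = 0 := by
  obtain ⟨K, k, hdim, hK⟩ := wordsums_of_slow_linPencil _ (slow_of_heavyTopInst_five_nine coef h)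
  have h1 := Submodule.finrank_le K
  rw [Module.finrank_fintype_fun_eq_card, Fintype.card_prod, Fintype.card_fin] at h1
  refine ⟨K, k, by omega, by omega, fun x v hv j hj i i' => hK x v hv j hj i i'⟩

end Frame

end Summit.ValiantsHypothesis.ValiantsHypothesis.Theorems.GrenetZeon.RadicalSplit

end
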